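import Summits.QuantumFields.QCD.Theorems.NestedDissectionSeaEarlyCrosserLawMeanCountForms
-- (p100297; transitively: …MeanCountReduction p98193, …MeanCount p97507, …Reduction p91005 (Form A/B, dilution_of_jensenLaw),
-- …StubCrossingCharge (p78628), …StubExcessRegular (p84131), Negative/CellPositivityDomain (p74201),
-- SpectralDefectExtinctionPositivityDeficitLeDefectsRootCount (sibling route: root-count USC), SpectralDefectDensity.

/-!
# Line `accretive-coarse-jensen` — skeleton v3 (lead continuation c1, 2026-08-16) for the crux
`EarlyCrosserLaw` (stmt-QuantumFields-13995), route `NestedDissectionSea` (QCD)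

RESHAPE (c1): the line's physics stub is RE-BASED from the two-circle Jensen form (`stub_jensenDilution`,
skeleton v2) to its WEAKER, canonical counting form `stub_meanCountLaw` — the phase-quenched MEAN NUMBER of
early real crossers (real eigenvalues `u ≤ −m_f(k)` of the massless Dirichlet cell matrices of the window box
and its 16 children, with multiplicity: `realSpecCount (wilsonCell U 0 x s) (−m_f(k))`, tree vocabulary of
`Literature/…/SpectralDefectDensity`) is `≤ δ_j` with `Σ_{j<J} δ_j ≤ ε`, for every admissible regularisation at
which the two-sided pin holds (threshold loss `C`).  Kernel-checked (landed companions p97507, p98193, p100297):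
`JensenDilution ⇒ MeanCountLaw` (`meanCountLaw_of_jensenDilution`: grid charge ≥ log 2 · count at EVERY radius)
and `MeanCountLaw ⇒ (a′)` (`dilution_of_meanCountLaw`: cover event ⇒ count ≥ 1, count measurable by root-count
upper semicontinuity, Markov).  So nothing of the line is lost and the promoted statement no longer mentions
circle averages or radii.  The pin stub is UNCHANGED and SHARED (`stub_pinnedLine`, also registered by the
kac-rice lead seat 1).

Composition: `EarlyCrosserLaw_skeleton : EarlyCrosserLaw :=
  EarlyCrosserLaw_of_pinnedLine_of_meanCountLaw stub_pinnedLine stub_meanCountLaw` (Form A″, landed).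
Sorries: exactly the two physics stubs.  NOT registered with `ledger skeleton check` by this seat (the registry
is held by the parallel kac-rice lead; registering would expire its stubs) — published as
`Cruxes/EarlyCrosserLaw/Lines/accretive_coarse_jensen.lean` only.
-/

noncomputable section

open scoped BigOperators Matrix ComplexConjugate
open Filter MeasureTheory
open Literature.MathematicalPhysics.QuantumLattice Literature.MathematicalPhysics.QuantumFieldTheory
  Literature.Probability.LatticeModels
open Summit.QuantumFields.QCD.Theses.NestedDissectionSea

namespace Summit.QuantumFields.QCD.Cruxes.EarlyCrosserLaw.AccretiveCoarseJensen

open scoped Classical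

/-- Stub P (YM topology, shared-crux grade, UNCHANGED from v2 and shared with line kac-rice): the two-sided
pinned line — clauses (b) ∧ (b″) of the crux with their own `∃ reg`. -/
theorem stub_pinnedLine :
    ∀ Nf : ℕ, (Nf = 2 ∨ Nf = 3) → ∃ reg : QCDRegularisation Nf, reg.HasMassScaling ∧
      (reg.scheme 0 0 0).HasAsymptoticScaling ∧ ∃ M₀ : ℝ, 0 ≤ M₀ ∧
      ∀ m : Fin Nf → ℝ, (∀ f, M₀ < m f) → ∃ R : ℝ, 0 < R ∧
        (∀ M : ℝ, M₀ < M → ∀ᶠ k : ℕ in Filter.atTop, ∀ S : ℕ, R ≤ reg.a k * (2 * S + 1) →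
          (1 / 4 : ℝ) ≤ (∫ U, (if (fermionDet (wilsonDirac (fundamentalRep (Fin 3)) U (reg.mcrit k - reg.a k * M / reg.Zm k) 1)).re < 0 then (1 : ℝ) else 0) * (∏ f, ‖fermionDet (wilsonDirac (fundamentalRep (Fin 3)) U (reg.mcrit k + reg.a k * m f / reg.Zm k) 1)‖) ∂(wilsonMeasure (fundamentalRep (Fin 3)) (reg.β k) : Measure (GaugeConfig 4 (2 * S + 1) (Matrix.specialUnitaryGroup (Fin 3) ℂ)))) /
            (∫ U, (∏ f, ‖fermionDet (wilsonDirac (fundamentalRep (Fin 3)) U (reg.mcrit k + reg.a k * m f / reg.Zm k) 1)‖) ∂(wilsonMeasure (fundamentalRep (Fin 3)) (reg.β k) : Measure (GaugeConfig 4 (2 * S + 1) (Matrix.specialUnitaryGroup (Fin 3) ℂ))))) ∧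
        (∀ M : ℝ, M₀ < M → ∀ᶠ k : ℕ in Filter.atTop, ∀ S : ℕ, R ≤ reg.a k * (2 * S + 1) → reg.a k * (2 * S + 1) ≤ 2 * R →
          (∫ U, (if (fermionDet (wilsonDirac (fundamentalRep (Fin 3)) U (reg.mcrit k + reg.a k * M / reg.Zm k) 1)).re < 0 then (1 : ℝ) else 0) * (∏ f, ‖fermionDet (wilsonDirac (fundamentalRep (Fin 3)) U (reg.mcrit k + reg.a k * m f / reg.Zm k) 1)‖) ∂(wilsonMeasure (fundamentalRep (Fin 3)) (reg.β k) : Measure (GaugeConfig 4 (2 * S + 1) (Matrix.specialUnitaryGroup (Fin 3) ℂ)))) /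
            (∫ U, (∏ f, ‖fermionDet (wilsonDirac (fundamentalRep (Fin 3)) U (reg.mcrit k + reg.a k * m f / reg.Zm k) 1)‖) ∂(wilsonMeasure (fundamentalRep (Fin 3)) (reg.β k) : Measure (GaugeConfig 4 (2 * S + 1) (Matrix.specialUnitaryGroup (Fin 3) ℂ)))) ≤ (1 / 8 : ℝ)) := by
  sorry

/-- Stub M (the line's physics, HARDEST, open-problem grade; replaces `stub_jensenDilution` of v2, which
implies it by `meanCountLaw_of_jensenDilution`): the **mean-count law of early real crossers** — for
`N_f ∈ {2,3}` and every admissible regularisation there are `b₀ ≥ 2`, `ℓ > 0`, `C ≥ 0` such that whenever the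
two-sided pin holds at `(M₀, m, R)` and `m_f > M₀ + C`: for every `ε > 0`, eventually in `k`, on every odd torus
of physical side `≥ R`, there is `δ ≥ 0` with `Σ_{j<J} δ_j ≤ ε` bounding, for every window box `s` at scale `j`,
the phase-quenched mean NUMBER (with multiplicity, summed over flavours) of real eigenvalues `u ≤ −m_f(k)` of
the massless Dirichlet cell matrices of the box and of its sixteen children.  Content: the route's carrier
census (L4)–(L5) at a two-sidedly pinned line (sharp open point: Disproof § 5, `κ₀(SU(3)) ≥ 4/b`). -/
theorem stub_meanCountLaw :
    ∀ Nf : ℕ, (Nf = 2 ∨ Nf = 3) → ∀ reg : QCDRegularisation Nf, reg.HasMassScaling →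
      (reg.scheme 0 0 0).HasAsymptoticScaling →
      ∃ b₀ : ℕ, 2 ≤ b₀ ∧ ∃ ℓ : ℝ, 0 < ℓ ∧ ∃ C : ℝ, 0 ≤ C ∧
      ∀ M₀ : ℝ, 0 ≤ M₀ → ∀ m : Fin Nf → ℝ, (∀ f, M₀ + C < m f) → ∀ R : ℝ, 0 < R →
        (∀ M : ℝ, M₀ < M → ∀ᶠ k : ℕ in Filter.atTop, ∀ S : ℕ, R ≤ reg.a k * (2 * S + 1) →
          (1 / 4 : ℝ) ≤ (∫ U, (if (fermionDet (wilsonDirac (fundamentalRep (Fin 3)) U (reg.mcrit k - reg.a k * M / reg.Zm k) 1)).re < 0 then (1 : ℝ) else 0) * (∏ f, ‖fermionDet (wilsonDirac (fundamentalRep (Fin 3)) U (reg.mcrit k + reg.a k * m f / reg.Zm k) 1)‖) ∂(wilsonMeasure (fundamentalRep (Fin 3)) (reg.β k) : Measure (GaugeConfig 4 (2 * S + 1) (Matrix.specialUnitaryGroup (Fin 3) ℂ)))) /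
            (∫ U, (∏ f, ‖fermionDet (wilsonDirac (fundamentalRep (Fin 3)) U (reg.mcrit k + reg.a k * m f / reg.Zm k) 1)‖) ∂(wilsonMeasure (fundamentalRep (Fin 3)) (reg.β k) : Measure (GaugeConfig 4 (2 * S + 1) (Matrix.specialUnitaryGroup (Fin 3) ℂ))))) →
        (∀ M : ℝ, M₀ < M → ∀ᶠ k : ℕ in Filter.atTop, ∀ S : ℕ, R ≤ reg.a k * (2 * S + 1) → reg.a k * (2 * S + 1) ≤ 2 * R →
          (∫ U, (if (fermionDet (wilsonDirac (fundamentalRep (Fin 3)) U (reg.mcrit k + reg.a k * M / reg.Zm k) 1)).re < 0 then (1 : ℝ) else 0) * (∏ f, ‖fermionDet (wilsonDirac (fundamentalRep (Fin 3)) U (reg.mcrit k + reg.a k * m f / reg.Zm k) 1)‖) ∂(wilsonMeasure (fundamentalRep (Fin 3)) (reg.β k) : Measure (GaugeConfig 4 (2 * S + 1) (Matrix.specialUnitaryGroup (Fin 3) ℂ)))) /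
            (∫ U, (∏ f, ‖fermionDet (wilsonDirac (fundamentalRep (Fin 3)) U (reg.mcrit k + reg.a k * m f / reg.Zm k) 1)‖) ∂(wilsonMeasure (fundamentalRep (Fin 3)) (reg.β k) : Measure (GaugeConfig 4 (2 * S + 1) (Matrix.specialUnitaryGroup (Fin 3) ℂ)))) ≤ (1 / 8 : ℝ)) →
        (∀ ε : ℝ, 0 < ε → ∀ᶠ k : ℕ in Filter.atTop, ∀ S : ℕ, R ≤ reg.a k * (2 * S + 1) →
          ∃ δ : ℕ → ℝ, (∀ j, 0 ≤ δ j) ∧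
            ∑ j ∈ Finset.range (Nat.log 2 (⌊ℓ / reg.a k⌋₊ / b₀) + 1), δ j ≤ ε ∧
            ∀ j < Nat.log 2 (⌊ℓ / reg.a k⌋₊ / b₀) + 1, ∀ s : Fin 4 → ℕ,
              (∀ i, b₀ * 2 ^ j ≤ s i ∧ s i < b₀ * 2 ^ (j + 2) ∧ s i ≤ 2 * S + 1 ∧
                (s i : ℝ) * reg.a k ≤ ℓ) →
              (∫ U, (∑ f, ((realSpecCount (wilsonCell U 0 (0 : TorusSite 4 (2 * S + 1)) s) (-(reg.mcrit k + reg.a k * m f / reg.Zm k)) : ℝ) +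
                    ∑ c : Fin 4 → Bool,
                      (realSpecCount (wilsonCell U 0 (halfCorner s c) (halfSides s c)) (-(reg.mcrit k + reg.a k * m f / reg.Zm k)) : ℝ))) *
                    (∏ f, ‖fermionDet (wilsonDirac (fundamentalRep (Fin 3)) U (reg.mcrit k + reg.a k * m f / reg.Zm k) 1)‖)
                  ∂(wilsonMeasure (fundamentalRep (Fin 3)) (reg.β k) : Measure (GaugeConfig 4 (2 * S + 1) (Matrix.specialUnitaryGroup (Fin 3) ℂ)))) /
                (∫ U, (∏ f, ‖fermionDet (wilsonDirac (fundamentalRep (Fin 3)) U (reg.mcrit k + reg.a k * m f / reg.Zm k) 1)‖)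
                  ∂(wilsonMeasure (fundamentalRep (Fin 3)) (reg.β k) : Measure (GaugeConfig 4 (2 * S + 1) (Matrix.specialUnitaryGroup (Fin 3) ℂ))))
              ≤ δ j) := by
  sorry

/-- Certificate: the v2 physics stub implies the v3 one (landed `meanCountLaw_of_jensenDilution`), so the
reshape only WEAKENS what is asked of physics. -/
theorem stub_meanCountLaw_of_jensenDilution
    (hDil : ∀ Nf : ℕ, (Nf = 2 ∨ Nf = 3) → ∀ reg : QCDRegularisation Nf, reg.HasMassScaling →
      (reg.scheme 0 0 0).HasAsymptoticScaling →
      ∃ b₀ : ℕ, 2 ≤ b₀ ∧ ∃ ℓ : ℝ, 0 < ℓ ∧ ∃ C : ℝ, 0 ≤ C ∧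
      ∀ M₀ : ℝ, 0 ≤ M₀ → ∀ m : Fin Nf → ℝ, (∀ f, M₀ + C < m f) → ∀ R : ℝ, 0 < R →
        (∀ M : ℝ, M₀ < M → ∀ᶠ k : ℕ in Filter.atTop, ∀ S : ℕ, R ≤ reg.a k * (2 * S + 1) →
          (1 / 4 : ℝ) ≤ (∫ U, (if (fermionDet (wilsonDirac (fundamentalRep (Fin 3)) U (reg.mcrit k - reg.a k * M / reg.Zm k) 1)).re < 0 then (1 : ℝ) else 0) * (∏ f, ‖fermionDet (wilsonDirac (fundamentalRep (Fin 3)) U (reg.mcrit k + reg.a k * m f / reg.Zm k) 1)‖) ∂(wilsonMeasure (fundamentalRep (Fin 3)) (reg.β k) : Measure (GaugeConfig 4 (2 * S + 1) (Matrix.specialUnitaryGroup (Fin 3) ℂ)))) /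
            (∫ U, (∏ f, ‖fermionDet (wilsonDirac (fundamentalRep (Fin 3)) U (reg.mcrit k + reg.a k * m f / reg.Zm k) 1)‖) ∂(wilsonMeasure (fundamentalRep (Fin 3)) (reg.β k) : Measure (GaugeConfig 4 (2 * S + 1) (Matrix.specialUnitaryGroup (Fin 3) ℂ))))) →
        (∀ M : ℝ, M₀ < M → ∀ᶠ k : ℕ in Filter.atTop, ∀ S : ℕ, R ≤ reg.a k * (2 * S + 1) → reg.a k * (2 * S + 1) ≤ 2 * R →
          (∫ U, (if (fermionDet (wilsonDirac (fundamentalRep (Fin 3)) U (reg.mcrit k + reg.a k * M / reg.Zm k) 1)).re < 0 then (1 : ℝ) else 0) * (∏ f, ‖fermionDet (wilsonDirac (fundamentalRep (Fin 3)) U (reg.mcrit k + reg.a k * m f / reg.Zm k) 1)‖) ∂(wilsonMeasure (fundamentalRep (Fin 3)) (reg.β k) : Measure (GaugeConfig 4 (2 * S + 1) (Matrix.specialUnitaryGroup (Fin 3) ℂ)))) /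
            (∫ U, (∏ f, ‖fermionDet (wilsonDirac (fundamentalRep (Fin 3)) U (reg.mcrit k + reg.a k * m f / reg.Zm k) 1)‖) ∂(wilsonMeasure (fundamentalRep (Fin 3)) (reg.β k) : Measure (GaugeConfig 4 (2 * S + 1) (Matrix.specialUnitaryGroup (Fin 3) ℂ)))) ≤ (1 / 8 : ℝ)) →
        (∀ ε : ℝ, 0 < ε → ∀ᶠ k : ℕ in Filter.atTop, ∀ S : ℕ, R ≤ reg.a k * (2 * S + 1) →
          ∃ δ : ℕ → ℝ, (∀ j, 0 ≤ δ j) ∧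
            ∑ j ∈ Finset.range (Nat.log 2 (⌊ℓ / reg.a k⌋₊ / b₀) + 1), δ j ≤ ε ∧
            ∀ j < Nat.log 2 (⌊ℓ / reg.a k⌋₊ / b₀) + 1, ∀ s : Fin 4 → ℕ,
              (∀ i, b₀ * 2 ^ j ≤ s i ∧ s i < b₀ * 2 ^ (j + 2) ∧ s i ≤ 2 * S + 1 ∧
                (s i : ℝ) * reg.a k ≤ ℓ) →
              ∃ r : Fin Nf → ℝ, (∀ f, 0 < r f) ∧
                (∫ U, (∑ f, ∑ n ∈ Finset.range
                    (⌊(-(reg.mcrit k + reg.a k * m f / reg.Zm k)) / (2 * r f)⌋₊ + 1),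
                    ((Real.circleAverage (fun z : ℂ => Real.log ‖((wilsonCell U 0 (0 : TorusSite 4 (2 * S + 1)) s).charpoly).eval z‖)
                        ((((2 * (n : ℝ) + 1) * r f : ℝ)) : ℂ) (2 * r f)
                      - Real.circleAverage (fun z : ℂ => Real.log ‖((wilsonCell U 0 (0 : TorusSite 4 (2 * S + 1)) s).charpoly).eval z‖)
                        ((((2 * (n : ℝ) + 1) * r f : ℝ)) : ℂ) (r f)) +
                      ∑ ε : Fin 4 → Bool,
                        (Real.circleAverage (fun z : ℂ => Real.log ‖((wilsonCell U 0 (halfCorner s ε) (halfSides s ε)).charpoly).eval z‖)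
                        ((((2 * (n : ℝ) + 1) * r f : ℝ)) : ℂ) (2 * r f)
                      - Real.circleAverage (fun z : ℂ => Real.log ‖((wilsonCell U 0 (halfCorner s ε) (halfSides s ε)).charpoly).eval z‖)
                        ((((2 * (n : ℝ) + 1) * r f : ℝ)) : ℂ) (r f)))) *
                    (∏ f, ‖fermionDet (wilsonDirac (fundamentalRep (Fin 3)) U (reg.mcrit k + reg.a k * m f / reg.Zm k) 1)‖)
                  ∂(wilsonMeasure (fundamentalRep (Fin 3)) (reg.β k) : Measure (GaugeConfig 4 (2 * S + 1) (Matrix.specialUnitaryGroup (Fin 3) ℂ)))) /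
                (∫ U, (∏ f, ‖fermionDet (wilsonDirac (fundamentalRep (Fin 3)) U (reg.mcrit k + reg.a k * m f / reg.Zm k) 1)‖)
                  ∂(wilsonMeasure (fundamentalRep (Fin 3)) (reg.β k) : Measure (GaugeConfig 4 (2 * S + 1) (Matrix.specialUnitaryGroup (Fin 3) ℂ))))
              ≤ δ j * Real.log 2)) :
    ∀ Nf : ℕ, (Nf = 2 ∨ Nf = 3) → ∀ reg : QCDRegularisation Nf, reg.HasMassScaling →
      (reg.scheme 0 0 0).HasAsymptoticScaling →
      ∃ b₀ : ℕ, 2 ≤ b₀ ∧ ∃ ℓ : ℝ, 0 < ℓ ∧ ∃ C : ℝ, 0 ≤ C ∧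
      ∀ M₀ : ℝ, 0 ≤ M₀ → ∀ m : Fin Nf → ℝ, (∀ f, M₀ + C < m f) → ∀ R : ℝ, 0 < R →
        (∀ M : ℝ, M₀ < M → ∀ᶠ k : ℕ in Filter.atTop, ∀ S : ℕ, R ≤ reg.a k * (2 * S + 1) →
          (1 / 4 : ℝ) ≤ (∫ U, (if (fermionDet (wilsonDirac (fundamentalRep (Fin 3)) U (reg.mcrit k - reg.a k * M / reg.Zm k) 1)).re < 0 then (1 : ℝ) else 0) * (∏ f, ‖fermionDet (wilsonDirac (fundamentalRep (Fin 3)) U (reg.mcrit k + reg.a k * m f / reg.Zm k) 1)‖) ∂(wilsonMeasure (fundamentalRep (Fin 3)) (reg.β k) : Measure (GaugeConfig 4 (2 * S + 1) (Matrix.specialUnitaryGroup (Fin 3) ℂ)))) /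
            (∫ U, (∏ f, ‖fermionDet (wilsonDirac (fundamentalRep (Fin 3)) U (reg.mcrit k + reg.a k * m f / reg.Zm k) 1)‖) ∂(wilsonMeasure (fundamentalRep (Fin 3)) (reg.β k) : Measure (GaugeConfig 4 (2 * S + 1) (Matrix.specialUnitaryGroup (Fin 3) ℂ))))) →
        (∀ M : ℝ, M₀ < M → ∀ᶠ k : ℕ in Filter.atTop, ∀ S : ℕ, R ≤ reg.a k * (2 * S + 1) → reg.a k * (2 * S + 1) ≤ 2 * R →
          (∫ U, (if (fermionDet (wilsonDirac (fundamentalRep (Fin 3)) U (reg.mcrit k + reg.a k * M / reg.Zm k) 1)).re < 0 then (1 : ℝ) else 0) * (∏ f, ‖fermionDet (wilsonDirac (fundamentalRep (Fin 3)) U (reg.mcrit k + reg.a k * m f / reg.Zm k) 1)‖) ∂(wilsonMeasure (fundamentalRep (Fin 3)) (reg.β k) : Measure (GaugeConfig 4 (2 * S + 1) (Matrix.specialUnitaryGroup (Fin 3) ℂ)))) /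
            (∫ U, (∏ f, ‖fermionDet (wilsonDirac (fundamentalRep (Fin 3)) U (reg.mcrit k + reg.a k * m f / reg.Zm k) 1)‖) ∂(wilsonMeasure (fundamentalRep (Fin 3)) (reg.β k) : Measure (GaugeConfig 4 (2 * S + 1) (Matrix.specialUnitaryGroup (Fin 3) ℂ)))) ≤ (1 / 8 : ℝ)) →
        (∀ ε : ℝ, 0 < ε → ∀ᶠ k : ℕ in Filter.atTop, ∀ S : ℕ, R ≤ reg.a k * (2 * S + 1) →
          ∃ δ : ℕ → ℝ, (∀ j, 0 ≤ δ j) ∧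
            ∑ j ∈ Finset.range (Nat.log 2 (⌊ℓ / reg.a k⌋₊ / b₀) + 1), δ j ≤ ε ∧
            ∀ j < Nat.log 2 (⌊ℓ / reg.a k⌋₊ / b₀) + 1, ∀ s : Fin 4 → ℕ,
              (∀ i, b₀ * 2 ^ j ≤ s i ∧ s i < b₀ * 2 ^ (j + 2) ∧ s i ≤ 2 * S + 1 ∧
                (s i : ℝ) * reg.a k ≤ ℓ) →
              (∫ U, (∑ f, ((realSpecCount (wilsonCell U 0 (0 : TorusSite 4 (2 * S + 1)) s) (-(reg.mcrit k + reg.a k * m f / reg.Zm k)) : ℝ) +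
                    ∑ c : Fin 4 → Bool,
                      (realSpecCount (wilsonCell U 0 (halfCorner s c) (halfSides s c)) (-(reg.mcrit k + reg.a k * m f / reg.Zm k)) : ℝ))) *
                    (∏ f, ‖fermionDet (wilsonDirac (fundamentalRep (Fin 3)) U (reg.mcrit k + reg.a k * m f / reg.Zm k) 1)‖)
                  ∂(wilsonMeasure (fundamentalRep (Fin 3)) (reg.β k) : Measure (GaugeConfig 4 (2 * S + 1) (Matrix.specialUnitaryGroup (Fin 3) ℂ)))) /
                (∫ U, (∏ f, ‖fermionDet (wilsonDirac (fundamentalRep (Fin 3)) U (reg.mcrit k + reg.a k * m f / reg.Zm k) 1)‖)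
                  ∂(wilsonMeasure (fundamentalRep (Fin 3)) (reg.β k) : Measure (GaugeConfig 4 (2 * S + 1) (Matrix.specialUnitaryGroup (Fin 3) ℂ))))
              ≤ δ j) :=
  meanCountLaw_of_jensenDilution hDil

/-- **The skeleton IS the crux proof modulo the two physics stubs**: `EarlyCrosserLaw` BY NAME from
`stub_pinnedLine` and `stub_meanCountLaw` through the landed Form-A″ reduction
`EarlyCrosserLaw_of_pinnedLine_of_meanCountLaw`.  Sorry-tainted only through the two stubs. -/
theorem EarlyCrosserLaw_skeleton : EarlyCrosserLaw :=
  EarlyCrosserLaw_of_pinnedLine_of_meanCountLaw stub_pinnedLine stub_meanCountLaw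

end Summit.QuantumFields.QCD.Cruxes.EarlyCrosserLaw.AccretiveCoarseJensen

end
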